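import Summits.QuantumFields.BalabanUV.Beta.GAN24.CapacitanceScalarRateSum
import Summits.QuantumFields.BalabanUV.Beta.GAN24.CapacitanceScalarBoundsBorder

/-!
# `BalabanUV.Beta.GAN24.CapacitanceScalarRateDict` — binder row G-an2-4 / (CONV-C), road P1-fibre, leaf **P1-Y11s** of
# `GAN24/Formal/LEAVES.md` v2.1 — DICTIONARY to leaf P1-Y08s (`GAN24/CapacitanceScalarBounds(Border)`, leaf-12): the rates in
# the currency `capDiag = a_κ`, `capBorder = σ` (bridged BY NAME, nothing twinned)

NOT IN PRINT; OUR PROOF ATTEMPT.  HONEST FRAMING (cell contract, verbatim): «discharging `BetaPertH` makes Bałaban's UV stability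
UNCONDITIONAL — a real constructive-QFT result; it is NOT the continuum limit and NOT the Clay problem.»  HONEST DEPENDENCY (verbatim):
«continuum YM on T⁴ ⇐ BetaPertH ∧ nine spine estimates (0/9 proved); BetaPertH ⇐ (D1) ∧ (D4) ∧ CAP+tail; G-an2-4 gates asym, D1 and
NE2/3/4.»  [folklore] bookkeeping (two `field_simp` identities and two rewrites); 0 cite, 0 wall binder, no `def … : Prop`; it discharges
NOTHING of (CONV-C)'s K-slot `GAN24.CombesThomas.ConvCK 3 Lc` by itself.  NOT `BetaPertH`, NOT continuum, NOT Clay.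

## What is proved (every `D`, `N ≥ 1`)
* `aw_eq_gNormSq_div` (`aw N x = gNormSq N x / N²`, `rfl`), **`capDiag_eq_pow_mul_aT`** (`a_κ(p) = N^{D+4}·ã_κ^{(N)}(p)`, i.e.
  `capDiag N p κ = N^(D+4) * aT N p κ`), **`capBorder_eq_pow_mul_sT`** (`σ(p) = N^{D+4}·σ̃^{(N)}(p)`);
* the TWO-SCALE RATES in leaf-12's currency, for all `1 ≤ N ≤ N'`, `p ∈ [−π, π]^D ∖ {0}`:
  **`capDiag_rate`**: `|capDiag N' p κ / N'^(D+4) − capDiag N p κ / N^(D+4)| ≤ rateA D / N²`,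
  **`capBorder_rate`**: `|capBorder N' p / N'^(D+4) − capBorder N p / N^(D+4)| ≤ rateS D·(1 + 1/|p|²)/N²`
  (`= CapacitanceScalarRateSum.aT_rate / sT_rate` BY NAME).  With `N = Lc^{j+1}`, `N' = Lc^{j+2}`: rate `θ^j`, `θ = Lc⁻²`.

Unit `b2b-balaban-gan24-formalise-leaf-07` (G-an2-4 formalisation swarm, leaf prover 07, gen 5), 2026-08-20.  Value = kernel bookkeeping
leaf toward the K-slot route P1 of binder row G-an2-4, NOT summit progress.
-/

noncomputable section

open Complex Finset
open scoped BigOperators Real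

namespace Summit.QuantumFields.BalabanUV.Beta.GAN24.CapacitanceScalarRateDict

open AliasWeights AliasWeightsSum CapacitanceScalarRate CapacitanceScalarRateBox CapacitanceScalarRateSum
open CapacitanceScalarBounds CapacitanceScalarBoundsBorder
open Literature.MathematicalPhysics.QuantumFieldTheory.King1986 (momSq)

variable {D : ℕ}

/-- [folklore] The two weight currencies: `aw N x = gNormSq N x / N²`. -/
theorem aw_eq_gNormSq_div (N : ℕ) (x : ℝ) : aw N x = gNormSq N x / (N : ℝ) ^ 2 := rfl

/-- [folklore] The product weight in the two currencies: `Π_i aw N (k_i) = (Π_i gNormSq N k_i) / (N²)^D`. -/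
theorem prod_aw_eq (N : ℕ) (k : Fin D → ℝ) :
    ∏ i, aw N (k i) = (∏ i, gNormSq N (k i)) / ((N : ℝ) ^ 2) ^ D := by
  simp only [aw_eq_gNormSq_div]
  rw [Finset.prod_div_distrib, Finset.prod_const, Finset.card_univ, Fintype.card_fin]

/-- **`a_κ(p) = N^{D+4}·ã_κ^{(N)}(p)`**: leaf-12's `capDiag` is `N^(D+4)` times this leaf's `aT`. [folklore] -/
theorem capDiag_eq_pow_mul_aT (N : ℕ) [NeZero N] (p : Fin D → ℝ) (κ : Fin D) :
    capDiag N p κ = (N : ℝ) ^ (D + 4) * aT N p κ := by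
  have hN : (N : ℝ) ≠ 0 := by exact_mod_cast NeZero.ne N
  unfold capDiag aT blockWt
  rw [Finset.mul_sum]
  refine Finset.sum_congr rfl fun m _ => ?_
  rw [prod_aw_eq, aw_eq_gNormSq_div]
  rcases eq_or_ne (lapR (kfine N p m)) 0 with h | h
  · rw [h]; simp
  · field_simp
    ring

/-- **`σ(p) = N^{D+4}·σ̃^{(N)}(p)`**: leaf-12's `capBorder` is `N^(D+4)` times this leaf's `sT`. [folklore] -/
theorem capBorder_eq_pow_mul_sT (N : ℕ) [NeZero N] (p : Fin D → ℝ) :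
    capBorder N p = (N : ℝ) ^ (D + 4) * sT N p := by
  have hN : (N : ℝ) ≠ 0 := by exact_mod_cast NeZero.ne N
  unfold capBorder sT blockWt
  rw [Finset.mul_sum]
  refine Finset.sum_congr rfl fun m _ => ?_
  rw [prod_aw_eq]
  rcases eq_or_ne (lapR (kfine N p m)) 0 with h | h
  · rw [h]; simp
  · field_simp
    ring

/-- **TWO-SCALE RATE of `a_κ` in leaf-12's currency**: `|a_κ^{(N')}/N'^{D+4} − a_κ^{(N)}/N^{D+4}| ≤ rateA D/N²`
(`1 ≤ N ≤ N'`, `p ∈ [−π, π]^D ∖ {0}`). [folklore; `aT_rate` BY NAME] -/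
theorem capDiag_rate {N N' : ℕ} [NeZero N] [NeZero N'] (hNN' : N ≤ N') {p : Fin D → ℝ} (hp : ∀ i, |p i| ≤ π)
    (hp0 : p ≠ 0) (κ : Fin D) :
    |capDiag N' p κ / (N' : ℝ) ^ (D + 4) - capDiag N p κ / (N : ℝ) ^ (D + 4)| ≤ rateA D / (N : ℝ) ^ 2 := by
  have hN : (N : ℝ) ≠ 0 := by exact_mod_cast NeZero.ne N
  have hN' : (N' : ℝ) ≠ 0 := by exact_mod_cast NeZero.ne N'
  rw [capDiag_eq_pow_mul_aT, capDiag_eq_pow_mul_aT, mul_div_cancel_left₀ _ (pow_ne_zero _ hN'),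
    mul_div_cancel_left₀ _ (pow_ne_zero _ hN)]
  exact aT_rate hNN' hp hp0 κ

/-- **TWO-SCALE RATE of `σ` in leaf-12's currency**: `|σ^{(N')}/N'^{D+4} − σ^{(N)}/N^{D+4}| ≤ rateS D·(1 + 1/|p|²)/N²`
(`1 ≤ N ≤ N'`, `p ∈ [−π, π]^D ∖ {0}`). [folklore; `sT_rate` BY NAME] -/
theorem capBorder_rate {N N' : ℕ} [NeZero N] [NeZero N'] (hNN' : N ≤ N') {p : Fin D → ℝ} (hp : ∀ i, |p i| ≤ π)
    (hp0 : p ≠ 0) :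
    |capBorder N' p / (N' : ℝ) ^ (D + 4) - capBorder N p / (N : ℝ) ^ (D + 4)|
      ≤ rateS D * (1 + 1 / momSq p) / (N : ℝ) ^ 2 := by
  have hN : (N : ℝ) ≠ 0 := by exact_mod_cast NeZero.ne N
  have hN' : (N' : ℝ) ≠ 0 := by exact_mod_cast NeZero.ne N'
  rw [capBorder_eq_pow_mul_sT, capBorder_eq_pow_mul_sT, mul_div_cancel_left₀ _ (pow_ne_zero _ hN'),
    mul_div_cancel_left₀ _ (pow_ne_zero _ hN)]
  exact sT_rate hNN' hp hp0

end Summit.QuantumFields.BalabanUV.Beta.GAN24.CapacitanceScalarRateDict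

end
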